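import Literature.MathematicalPhysics.PowerSystems.DroopKuramotoTypeCount
import Literature.MathematicalPhysics.PowerSystems.KuramotoRingStabilityDichotomy
import Literature.MathematicalPhysics.PowerSystems.RingTwistedStateInstability
import HarnessLib

/-!
# The twisted states of the first-order KURAMOTO ring: fixed points, TYPE `0` with an exponential
# rate when `4|q| < N`, maximal type `N − 1` when `cos(2πq/N) < 0` — the sign pattern of
# `γ_ℓ(q) = −4cos(2πq/N)sin²(πℓ/N)` in the print's own (first-order) model

Topic `Literature/MathematicalPhysics/PowerSystems`, namespace
`Literature.MathematicalPhysics.PowerSystems.NonuniformKuramoto`. Companion of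
`RingTwistedStateType.lean` (the same statements for the damped SECOND-ORDER swing ring
`ClassicalModel.ringSystem`). The printed sources on twisted states (Wiley–Strogatz–Girvan 2006;
Mihara et al. 2022; Delabays–Coletta–Jacquod 2016) are about the FIRST-ORDER Kuramoto ring
`θ̇ⱼ = ω + Σ_{k ~ j} sin(θₖ − θⱼ)`; in the co-rotating frame and in the edge-difference coordinates the
Jacobian at the `q`-twisted state has the eigenvalues `γ_ℓ = −4cos(2πq/N)sin²(πℓ/N)`,
`ℓ = 1, …, N − 1` [MiharaEtAl2022, §2.3 (arXiv:2111.13583 p. 6: «the condition for stability is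
γ_ℓ < 0, which implies that |q| < N/4»)]. This file types the SIGN PATTERN of that spectrum as the
root counts of the characteristic polynomial of the full `N × N` Jacobian `−D⁻¹L(θ_q)`
(`DroopNetwork.auxJac`, Chiang's dimension-reduction system (6.3)) of the non-uniform first-order
ring `Dᵢθ̇ᵢ = −Σⱼ Cᵢⱼ sin(θᵢ − θⱼ)` (homogeneous ring weights `K > 0`, zero natural frequencies after
the shift, ANY time constants `Dᵢ > 0` — the print has `Dᵢ = 1`), given as hypotheses on a general
`NonuniformKuramoto (n + 1)` exactly as in `KuramotoRingStabilityDichotomy.lean`: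

* `ring_twistedState_locked` — the twisted states `θ_q` (`ClassicalModel.twistedState n q`) are
  phase-locked states (fixed points in the co-rotating frame) of the Kuramoto ring, `N = n + 1 ≥ 3`.
* **`ring_twistedState_typeZero`** (`4|q| < N`): the complex characteristic roots of `−D⁻¹L(θ_q)`
  number `0` with positive real part, `N − 1` with negative real part, `1` on the axis (the rotation):
  all `γ_ℓ < 0` — a hyperbolic sink modulo the rotation; **`ring_twistedState_expStable`**: the
  locked solution `θ_q` attracts at an exponential rate modulo the rotation (`∃ ρ, k, λ > 0`).
* **`ring_twistedState_typeMax`** (`cos(2πq/N) < 0`): counts `(N − 1, 0, 1)` — all `γ_ℓ > 0`, every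
  transversal direction unstable (Chiang's type `N − 1`); `ring_twistedState_unstable`: the locked
  solution is unstable (motions; `ring_lockedSolution_unstable_of_long_line` BY NAME).

Everything is PROVED from the tree BY NAME (`NonuniformKuramoto.typeZero/typeMax_toDroopNetwork_auxJac_…`,
`ClassicalModel.hessForm_twistedState_neg`, `ClassicalModel.twistedState_normalOperation`,
`ClassicalModel.LosslessSystem.hessForm_pos_of_cohesive_of_connected`,
`ring_lockedSolution_expStable_of_normalOperation`); no definition, no named fact, no axiom.

THREE COLUMNS. CERTIFIED for MODEL `M` = first-order Kuramoto ring with homogeneous coupling and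
identical natural frequencies (co-rotating frame), any `Dᵢ > 0`, at its twisted states; «type» and
«rate» are properties of the MODEL's fixed points (the eigenvalue FORMULA `γ_ℓ` itself is not typed —
only its sign pattern, as root counts with multiplicity). The borderline `cos(2πq/N) = 0` is not
covered. Nothing about any grid.

## References
* [MiharaEtAl2022] A. Mihara, E. S. Medeiros, A. Zakharova, R. O. Medrano-T, *Sparsity-driven
  synchronization in oscillator networks*, Chaos 32 (2022) 033114, arXiv:2111.13583, §2.1 (twisted
  states `θⱼ = 2πqj/N + C`), §2.3 (the eigenvalues `γ_ℓ`, stability iff `|q| < N/4`).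
* [WileyStrogatzGirvan2006] D. A. Wiley, S. H. Strogatz, M. Girvan, *The size of the sync basin*,
  Chaos 16 (2006) 015103.
* [DelabaysColettaJacquod2016] R. Delabays, T. Coletta, P. Jacquod, J. Math. Phys. 57 (2016) 032701,
  §4.2 Thm 4.1.
* [ManikTimmeWitthaut2017] D. Manik, M. Timme, D. Witthaut, Chaos 27 (2017) 083123, §3 Lemma 1, Cor. 1.
* [Chiang1995] H.-D. Chiang, C.-C. Chu, G. Cauley, Proc. IEEE 83 (1995), §2 (type-k), §6.2 (6.3),
  Thm 6.7 (R1).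
* [Khalil2002] H. K. Khalil, *Nonlinear Systems*, 3rd ed., Theorem 4.7.

AI-produced formalisation (LADDER-GRIDFUSION seat gridfusion-lit-2 g11, 2026-08-28).
-/

set_option autoImplicit false

noncomputable section

open Real Set Finset Matrix
open scoped Matrix BigOperators

namespace Literature.MathematicalPhysics.PowerSystems

namespace NonuniformKuramoto

variable {n : ℕ} (Kur : NonuniformKuramoto (n + 1)) (K : ℝ) (q : ℤ)

/-! ### §1. Twisted states are phase-locked states of the Kuramoto ring -/

/-- The `q`-twisted state `θⱼ = 2πqj/N` is a phase-locked state of the Kuramoto ring (`N = n + 1 ≥ 3`):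
`fieldᵢ(θ_q) = Σω/ΣD (= 0)` — «the system … has a number of equilibrium states (in the rotating
frame) … θⱼ = 2πqj/N + C». [cite: MiharaEtAl2022, §2.1 (arXiv:2111.13583 p. 5: twisted states); ManikTimmeWitthaut2017, §3 («Both models have the same fixed points»)] -/
theorem ring_twistedState_locked (hn : 2 ≤ n) (hD : ∀ i, 0 < Kur.D i) (hω : ∀ i, Kur.ω i = 0)
    (hP : ∀ i j, Kur.P i j = if j = finRotate (n + 1) i ∨ i = finRotate (n + 1) j then K else 0)
    (hφ : ∀ i j, Kur.φ i j = 0) :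
    ∀ i, Kur.field (ClassicalModel.twistedState n q) i = (∑ j, Kur.ω j) / ∑ j, Kur.D j :=
  (Kur.ring_locked_iff_flow_eq_zero K hD hω hP hφ _).2
    fun k => ClassicalModel.ringSystem_flow_twistedState K Kur.D Kur.D q hn k

/-- The Kuramoto weights of the ring are symmetric. [cite: MiharaEtAl2022, §2.1 («A_kj = A_jk»)] -/
private theorem ring_P_symm
    (hP : ∀ i j, Kur.P i j = if j = finRotate (n + 1) i ∨ i = finRotate (n + 1) j then K else 0) :
    ∀ i j, Kur.P i j = Kur.P j i := by
  intro i j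
  rw [Kur.ring_P_eq_C K hP]
  exact ClassicalModel.ringSystem_C_symm K Kur.D Kur.D i j

/-- The linearised form of the Kuramoto ring at `θ` is the Hesse form of the swing ring:
`Σᵢ vᵢ Σⱼ Pᵢⱼcos(θᵢ − θⱼ)(vᵢ − vⱼ) = ½ΣΣ Cᵢⱼcos(θᵢ − θⱼ)(vᵢ − vⱼ)²`.
[cite: ManikTimmeWitthaut2017, §3 Lemma 1 proof (the Laplacian `M(θ*)` common to both models)] -/
private theorem ring_linForm_eq_hessForm
    (hP : ∀ i j, Kur.P i j = if j = finRotate (n + 1) i ∨ i = finRotate (n + 1) j then K else 0)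
    (θ v : Fin (n + 1) → ℝ) :
    ∑ i, v i * ∑ j, Kur.P i j * Real.cos (θ i - θ j) * (v i - v j)
      = 1 / 2 * ∑ i, ∑ j, (ClassicalModel.ringSystem n K Kur.D Kur.D).C i j
          * Real.cos (θ i - θ j) * (v i - v j) ^ 2 := by
  have hPs := Kur.ring_P_symm K hP
  have hw : ∀ i j, Kur.P i j * Real.cos (θ i - θ j) = Kur.P j i * Real.cos (θ j - θ i) := by
    intro i j
    rw [hPs i j, ← Real.cos_neg, neg_sub]
  rw [DroopNetwork.lapForm_eq_half_sum hw v, Kur.ring_P_eq_C K hP]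

/-! ### §2. `4|q| < N`: type `0` (all `γ_ℓ < 0`) and the exponential rate -/

/-- **STABLE TWISTED STATES OF THE KURAMOTO RING ARE HYPERBOLIC SINKS MODULO THE ROTATION**
(`K > 0`, any `Dᵢ > 0`, `4|q| < N`, `N = n + 1`): the complex characteristic roots of the Jacobian
`−D⁻¹L(θ_q)` (weights `Pᵢⱼcos(θ_{q,i} − θ_{q,j})`) number `0` with positive real part, `N − 1` with
negative real part and exactly `1` on the imaginary axis (the rotation `𝟙`) — the sign pattern
«γ_ℓ < 0 for all ℓ = 1, …, N − 1» of the print («the condition for stability is γ_ℓ < 0, which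
implies that |q| < N/4»), type `0` in Chiang's sense.
[cite: MiharaEtAl2022, §2.3 (arXiv:2111.13583 p. 6, γ_ℓ = −4cos(2πq/N)sin²(πℓ/N)); WileyStrogatzGirvan2006, (q-twisted states stable iff |q| < N/4); Chiang1995, §2 (type-k), §6 Thm 6.7 (R1); ManikTimmeWitthaut2017, §3 Lemma 1] -/
theorem ring_twistedState_typeZero (hK : 0 < K) (hD : ∀ i, 0 < Kur.D i)
    (hP : ∀ i j, Kur.P i j = if j = finRotate (n + 1) i ∨ i = finRotate (n + 1) j then K else 0)
    (hq : 4 * |q| < (n : ℤ) + 1) (i₀ : Fin (n + 1)) :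
    ((Kur.toDroopNetwork.auxJac (ClassicalModel.twistedState n q)).map (algebraMap ℝ ℂ)).charpoly.roots.countP
        (fun μ => 0 < μ.re) = 0 ∧
      ((Kur.toDroopNetwork.auxJac (ClassicalModel.twistedState n q)).map (algebraMap ℝ ℂ)).charpoly.roots.countP
        (fun μ => μ.re < 0) = n ∧
      ((Kur.toDroopNetwork.auxJac (ClassicalModel.twistedState n q)).map (algebraMap ℝ ℂ)).charpoly.roots.countP
        (fun μ => μ.re = 0) = 1 := by
  set S := ClassicalModel.ringSystem n K Kur.D Kur.D with hS
  have hPs := Kur.ring_P_symm K hP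
  -- the Hesse form at `θ_q` is positive on non-constant directions (normal operation, connected ring)
  have hpos : ∀ v : Fin (n + 1) → ℝ, (∃ i j, v i ≠ v j) →
      0 < ∑ i, v i * ∑ j, Kur.P i j * Real.cos (ClassicalModel.twistedState n q i
        - ClassicalModel.twistedState n q j) * (v i - v j) := by
    intro v hv
    rw [Kur.ring_linForm_eq_hessForm K hP]
    have h := S.hessForm_pos_of_cohesive_of_connected (ClassicalModel.ringSystem_C_nonneg K Kur.D Kur.D hK.le)
      (ClassicalModel.ringSystem_couplingConnected K Kur.D Kur.D hK)
      (ClassicalModel.twistedState_normalOperation K Kur.D Kur.D q hq) v hv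
    simpa only [Fin.sum_univ_zero, Finset.sum_const_zero, add_zero] using h
  -- constant directions give the value `0`
  have hzero : ∀ a : ℝ, ∑ i, (fun _ : Fin (n + 1) => a) i * ∑ j, Kur.P i j
      * Real.cos (ClassicalModel.twistedState n q i - ClassicalModel.twistedState n q j)
      * ((fun _ : Fin (n + 1) => a) i - (fun _ : Fin (n + 1) => a) j) = 0 := by
    intro a
    simp
  have hpsd : ∀ u : Fin (n + 1) → ℝ, 0 ≤ ∑ i, u i * ∑ j, Kur.P i j
      * Real.cos (ClassicalModel.twistedState n q i - ClassicalModel.twistedState n q j) * (u i - u j) := by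
    intro u
    by_cases hu : ∃ i j, u i ≠ u j
    · exact (hpos u hu).le
    · push Not at hu
      have hc : u = fun _ => u i₀ := funext fun i => hu i i₀
      rw [hc]
      exact (hzero (u i₀)).ge
  have hker : ∀ u : Fin (n + 1) → ℝ, ∑ i, u i * ∑ j, Kur.P i j
      * Real.cos (ClassicalModel.twistedState n q i - ClassicalModel.twistedState n q j) * (u i - u j) = 0 →
      ∃ a : ℝ, u = fun _ => a := by
    intro u hu
    by_cases hne : ∃ i j, u i ≠ u j
    · exact absurd hu (hpos u hne).ne'
    · push Not at hne
      exact ⟨u i₀, funext fun i => hne i i₀⟩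
  have h := Kur.typeZero_toDroopNetwork_auxJac_of_posCurvature hPs hD hpsd hker i₀
  simpa only [Nat.add_sub_cancel] using h

/-- **STABLE TWISTED STATES OF THE KURAMOTO RING ATTRACT AT AN EXPONENTIAL RATE MODULO THE
ROTATION** (`N = n + 1 ≥ 3`, `K > 0`, any `Dᵢ > 0`, zero natural frequencies, `4|q| < N`): there are
`ρ, k, λ > 0` such that every solution of the Kuramoto ring on `[0, T]` with `‖θ(0) − θ_q‖ < ρ`
satisfies `‖θ(t) − (θ_q + c𝟙)‖ ≤ k‖θ(0) − (θ_q + c𝟙)‖e^{−λt}`, `c = ΣDᵢ(θᵢ(0) − θ_{q,i})/ΣDᵢ`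
(`ring_lockedSolution_expStable_of_normalOperation` at the twisted state, which is in normal
operation: every line cosine equals `cos(2πq/N) > 0`).
[cite: WileyStrogatzGirvan2006, (q-twisted states stable for |q| < N/4); MiharaEtAl2022, §2.3; ManikTimmeWitthaut2017, §3 Cor. 1; Khalil2002, Theorem 4.7] -/
theorem ring_twistedState_expStable (hn : 2 ≤ n) (hK : 0 < K) (hD : ∀ i, 0 < Kur.D i)
    (hω : ∀ i, Kur.ω i = 0)
    (hP : ∀ i j, Kur.P i j = if j = finRotate (n + 1) i ∨ i = finRotate (n + 1) j then K else 0)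
    (hφ : ∀ i j, Kur.φ i j = 0) (hq : 4 * |q| < (n : ℤ) + 1) :
    ∃ ρ > 0, ∃ k > 0, ∃ lam > 0, ∀ (θ : ℝ → Fin (n + 1) → ℝ) (T : ℝ),
      (∀ t ∈ Icc 0 T, HasDerivWithinAt θ (Kur.field (θ t)) (Icc 0 T) t) →
      ‖θ 0 - ClassicalModel.twistedState n q‖ < ρ →
      ∀ t ∈ Icc 0 T,
        ‖θ t - fun i => ClassicalModel.twistedState n q i
            + Kur.D ⬝ᵥ (θ 0 - ClassicalModel.twistedState n q) / (∑ i, Kur.D i)‖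
          ≤ k * ‖θ 0 - fun i => ClassicalModel.twistedState n q i
              + Kur.D ⬝ᵥ (θ 0 - ClassicalModel.twistedState n q) / ∑ i, Kur.D i‖ * Real.exp (-lam * t) := by
  have hcos : 0 < Real.cos (2 * π * q / (n + 1)) := by
    -- any edge of the ring has a positive weight, and normal operation gives its cosine positive
    have h1 : ((finRotate (n + 1) 0 : Fin (n + 1)) : ℕ) = 1 := by
      rw [finRotate_apply_zero, Fin.val_one', Nat.mod_eq_of_lt (by omega)]
    have h01 : (0 : Fin (n + 1)) ≠ finRotate (n + 1) 0 := by
      intro h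
      have h' := congrArg Fin.val h
      rw [h1, Fin.val_zero] at h'
      exact absurd h' (by norm_num)
    have hC : 0 < (ClassicalModel.ringSystem n K Kur.D Kur.D).C 0 (finRotate (n + 1) 0) := by
      rw [ClassicalModel.ringSystem_C, if_pos (Or.inl rfl)]
      exact hK
    have h := ClassicalModel.twistedState_normalOperation K Kur.D Kur.D q hq 0 (finRotate (n + 1) 0) h01 hC
    rwa [ClassicalModel.cos_twisted_edge] at h
  have hno : ∀ k, 0 < Real.cos (ClassicalModel.twistedState n q k
      - ClassicalModel.twistedState n q (finRotate (n + 1) k)) := fun k => by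
    rw [ClassicalModel.cos_twisted_edge]; exact hcos
  exact Kur.ring_lockedSolution_expStable_of_normalOperation K hK hD hω hP hφ
    (Kur.ring_twistedState_locked K q hn hD hω hP hφ) hno

/-! ### §3. `cos(2πq/N) < 0`: maximal type `N − 1` (all `γ_ℓ > 0`) and instability -/

/-- **UNSTABLE TWISTED STATES OF THE KURAMOTO RING HAVE THE MAXIMAL TYPE `N − 1`** (`K > 0`, any
`Dᵢ > 0`, `cos(2πq/N) < 0`, i.e. `N/4 < |q| mod N < 3N/4`): the complex characteristic roots of
`−D⁻¹L(θ_q)` number `N − 1` with positive real part, `0` with negative real part and `1` on the axis —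
EVERY transversal direction is unstable, the sign pattern «γ_ℓ > 0 for all ℓ» of
`γ_ℓ = −4cos(2πq/N)sin²(πℓ/N)`.
[cite: MiharaEtAl2022, §2.3 (arXiv:2111.13583 p. 6, eigenvalues γ_ℓ); ManikTimmeWitthaut2017, §3 Lemma 1 (unstable direction); Chiang1995, §2 (type-k), §6 Thm 6.7 (R1)] -/
theorem ring_twistedState_typeMax (hK : 0 < K) (hD : ∀ i, 0 < Kur.D i)
    (hP : ∀ i j, Kur.P i j = if j = finRotate (n + 1) i ∨ i = finRotate (n + 1) j then K else 0)
    (hcos : Real.cos (2 * π * q / (n + 1)) < 0) (i₀ : Fin (n + 1)) :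
    ((Kur.toDroopNetwork.auxJac (ClassicalModel.twistedState n q)).map (algebraMap ℝ ℂ)).charpoly.roots.countP
        (fun μ => 0 < μ.re) = n ∧
      ((Kur.toDroopNetwork.auxJac (ClassicalModel.twistedState n q)).map (algebraMap ℝ ℂ)).charpoly.roots.countP
        (fun μ => μ.re < 0) = 0 ∧
      ((Kur.toDroopNetwork.auxJac (ClassicalModel.twistedState n q)).map (algebraMap ℝ ℂ)).charpoly.roots.countP
        (fun μ => μ.re = 0) = 1 := by
  have hPs := Kur.ring_P_symm K hP
  have hform : ∀ v : Fin (n + 1) → ℝ, (∃ i j, v i ≠ v j) →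
      ∑ i, v i * ∑ j, Kur.P i j * Real.cos (ClassicalModel.twistedState n q i
        - ClassicalModel.twistedState n q j) * (v i - v j) < 0 := by
    intro v hv
    rw [Kur.ring_linForm_eq_hessForm K hP]
    exact ClassicalModel.hessForm_twistedState_neg K Kur.D Kur.D q hK hcos v hv
  have h := Kur.typeMax_toDroopNetwork_auxJac_of_negCurvature hPs hD hform i₀
  simpa only [Nat.add_sub_cancel] using h

/-- **UNSTABLE TWISTED STATES OF THE KURAMOTO RING** (`N = n + 1 ≥ 3`, `K > 0`, any `Dᵢ > 0`, zero
natural frequencies, `cos(2πq/N) < 0`): the locked solution `θ_q` is unstable — there is `ε > 0` such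
that for every `η > 0` some phase vector `x₁` with `‖x₁ − θ_q‖ < η` has all forward motions leave the
`ε`-ball around `θ_q` (every line of `θ_q` has the negative cosine `cos(2πq/N)`;
`ring_lockedSolution_unstable_of_long_line`).
[cite: WileyStrogatzGirvan2006, (q-twisted states unstable for |q| > N/4); MiharaEtAl2022, §2.3; DelabaysColettaJacquod2016, §4.2 Thm 4.1; Khalil2002, Theorem 4.7 (part 2)] -/
theorem ring_twistedState_unstable (hn : 2 ≤ n) (hK : 0 < K) (hD : ∀ i, 0 < Kur.D i)
    (hω : ∀ i, Kur.ω i = 0)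
    (hP : ∀ i j, Kur.P i j = if j = finRotate (n + 1) i ∨ i = finRotate (n + 1) j then K else 0)
    (hφ : ∀ i j, Kur.φ i j = 0) (hcos : Real.cos (2 * π * q / (n + 1)) < 0) :
    ∃ ε > 0, ∀ η > 0, ∃ x₁ : Fin (n + 1) → ℝ, ‖x₁ - ClassicalModel.twistedState n q‖ < η ∧
      ∀ θ : ℝ → Fin (n + 1) → ℝ,
        (∀ T : ℝ, ∀ t ∈ Icc 0 T, HasDerivWithinAt θ (Kur.field (θ t)) (Icc 0 T) t) → θ 0 = x₁ →
        ∃ t : ℝ, 0 ≤ t ∧ ε < ‖θ t - ClassicalModel.twistedState n q‖ :=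
  Kur.ring_lockedSolution_unstable_of_long_line K hn hK hD hω hP hφ
    (Kur.ring_twistedState_locked K q hn hD hω hP hφ)
    ⟨0, by rw [ClassicalModel.cos_twisted_edge]; exact hcos⟩

end NonuniformKuramoto

end Literature.MathematicalPhysics.PowerSystems

end
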